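import Mathlib.Combinatorics.SimpleGraph.Walk.Counting
import Mathlib.Combinatorics.SimpleGraph.Paths
import Mathlib.Combinatorics.SimpleGraph.DeleteEdges
import Mathlib.Topology.Algebra.InfiniteSum.ENNReal
import Summits.CriticalPhenomena.SAWScalingLimit.Theorems.SAWTotalPositivityBoundaryTP2Defs
import Summits.CriticalPhenomena.SAWScalingLimit.Theorems.SAWTotalPositivityBoundaryTP2Kernel
import Summits.CriticalPhenomena.SAWScalingLimit.Theorems.SAWTotalPositivityBoundaryTP2Symmetry
import Summits.CriticalPhenomena.SAWScalingLimit.Theorems.SAWTotalPositivityBoundaryTP2Avoid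
import Summits.CriticalPhenomena.SAWScalingLimit.Theorems.SAWTotalPositivityBoundaryTP2SquareGadget
import Summits.CriticalPhenomena.SAWScalingLimit.Theorems.SAWTotalPositivityBoundaryTP2CutVertex
import Summits.CriticalPhenomena.SAWScalingLimit.Theorems.SAWLeftRightFKGLeftRightFKGInterlacedOfGraphTP2
import HarnessLib

/-!
# Crux `LeftRightFKG` (stmt-CriticalPhenomena-11232), line `corner-localisation` (skeleton v8):
the three-point inequality at a vertex with two escape chains

Registered stub `stub_twoChainThreePoint`. Let `Z = BoundaryTP2.pathKernel H x` be the fugacity-`x`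
self-avoiding path kernel of a subgraph `H ≤ ℤ²` with finitely many non-isolated vertices. The CHAIN GADGET
(the neighbouring stub `stub_chainGadget`, taken here as the hypothesis `hGL`) is the three-point inequality
`Z(c,a) Z(c,b) ≤ Z(a,b)` at a vertex `c` carrying an escape chain `c–p–b` through an isolated lattice vertex `p`,
under the two realisability conditions `(H − c).Reachable a b` and `(H − b).Reachable a c`
(`H − v := H.deleteEdges (H.incidenceSet v)`). This file removes the two conditions when there is a SECOND
chain `c–q–a`:

* if `c` does not reach `a` in `H`, then `Z(c,a) = 0`;
* if `c` separates `a` from `b` (no walk `a → b` of `H − c`), the cut-vertex factorisation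
  `BoundaryTP2.stub_cutVertex_factor` at `c` (cut data from `ThreePoint.exists_cut_sets`) gives the EQUALITY
  `Z(c,a) Z(c,b) = Z(a,b)`;
* otherwise the `p`-chain applies unless `b` separates `a` from `c`, and the `q`-chain (mirror instance of
  `hGL`) applies unless `a` separates `b` from `c`; both separations at once are impossible: a self-avoiding
  path `c → a` either avoids `b` (a walk of `H − b`) or its initial segment up to `b` avoids its endpoint `a`
  (a walk `c → b` of `H − a`).

Everything proved; Mathlib and the sibling toolkit only. [folklore]
-/

noncomputable section
open Literature.Probability.LatticeModels
open Summit.CriticalPhenomena.SAWScalingLimit.Theorems.BoundaryTP2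
open scoped ENNReal

namespace Summit.CriticalPhenomena.SAWScalingLimit.Theorems.LeftRightFKG.CornerGadget

variable {V : Type*}

/-- The edges of a walk of `H` avoiding the vertex `c` are edges of `H.deleteEdges (H.incidenceSet c)`
(adapted from the private helper of `…BoundaryTP2Avoid`). [folklore] -/
private theorem edges_mem_edgeSet_deleteEdges_incidenceSet {H : SimpleGraph V} {c u v : V}
    (p : H.Walk u v) (hc : c ∉ p.support) :
    ∀ e, e ∈ p.edges → e ∈ (H.deleteEdges (H.incidenceSet c)).edgeSet := by
  intro e he
  rw [SimpleGraph.edgeSet_deleteEdges]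
  exact ⟨p.edges_subset_edgeSet he,
    fun hinc => hc (SimpleGraph.Walk.mem_support_of_mem_edges he hinc.2)⟩

/-- A walk of `H` avoiding the vertex `c` witnesses reachability in `H − c = H.deleteEdges (H.incidenceSet c)`
(transfer the walk). [folklore] -/
private theorem reachable_deleteEdges_incidenceSet_of_walk {H : SimpleGraph V} {c u v : V}
    (p : H.Walk u v) (hc : c ∉ p.support) : (H.deleteEdges (H.incidenceSet c)).Reachable u v :=
  ⟨p.transfer _ (edges_mem_edgeSet_deleteEdges_incidenceSet p hc)⟩

/-- **Three-point inequality at a vertex with two escape chains** (registered stub `stub_twoChainThreePoint`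
of line `corner-localisation`, skeleton v8). From the chain-gadget statement at fugacity `x ≥ 0` alone: for
pairwise distinct `c, a, b` of a finite `H ≤ ℤ²` and isolated `p ≠ q` with `p` lattice-adjacent to `c, b` and
`q` to `c, a`, `Z(c,a) Z(c,b) ≤ Z(a,b)`. If `c` does not reach `a` the left side vanishes; if `c` separates
`a` from `b` it is an equality (cut-vertex factorisation at `c`); otherwise the `p`-chain applies unless `b`
separates `a` from `c`, the `q`-chain unless `a` separates `b` from `c`, and both separations contradict a
self-avoiding path `c → a` (it avoids `b`, or its initial segment up to `b` avoids `a`). [folklore] -/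
theorem stub_twoChainThreePoint : ∀ x : ℝ, 0 ≤ x →
    (∀ (H : SimpleGraph (Site 2)), H ≤ zdGraph 2 → H.support.Finite →
      ∀ c a b p : Site 2, c ≠ a → c ≠ b → a ≠ b → p ∉ H.support → (zdGraph 2).Adj c p → (zdGraph 2).Adj p b →
        (H.deleteEdges (H.incidenceSet c)).Reachable a b → (H.deleteEdges (H.incidenceSet b)).Reachable a c →
        pathKernel H x c a * pathKernel H x c b ≤ pathKernel H x a b) →
    ∀ (H : SimpleGraph (Site 2)), H ≤ zdGraph 2 → H.support.Finite →
    ∀ c a b p q : Site 2, c ≠ a → c ≠ b → a ≠ b → p ≠ q → p ∉ H.support → q ∉ H.support →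
      (zdGraph 2).Adj c p → (zdGraph 2).Adj p b → (zdGraph 2).Adj c q → (zdGraph 2).Adj q a →
      pathKernel H x c a * pathKernel H x c b ≤ pathKernel H x a b := by
  intro x hx hGL H hH hfin c a b p q hca hcb hab _hpq hp hq hcp hpb hcq hqa
  classical
  -- (0) trivial when `c` does not reach `a`
  by_cases hreach : H.Reachable c a
  swap
  · rw [pathKernel_eq_zero_of_not_reachable H x hreach, zero_mul]; exact zero_le
  -- (1) `c` separates `a` from `b`: equality by the cut-vertex factorisation at `c`
  by_cases hii : (H.deleteEdges (H.incidenceSet c)).Reachable a b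
  swap
  · have hz : ∀ (s t : Site 2) (w : H.Walk s t), s ∈ ({a} : Set (Site 2)) → t ∈ ({b} : Set (Site 2)) →
        c ∈ w.support := by
      intro s t w hs ht
      rw [Set.mem_singleton_iff] at hs ht
      subst hs ht
      by_contra hcw
      exact hii (reachable_deleteEdges_incidenceSet_of_walk w hcw)
    obtain ⟨A, B, hAB, hc, hcA, hcB, hsep, hS, hT⟩ := ThreePoint.exists_cut_sets H {a} {b} c hz
    have haA : a ∈ A := hS a (Set.mem_singleton a)
    have hbB : b ∈ B := hT b (Set.mem_singleton b)
    have hf1 := stub_cutVertex_factor H x hx A B c a b hAB hc hcA hcB hsep haA hbB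
    have hf2 := stub_cutVertex_factor H x hx A B c a c hAB hc hcA hcB hsep haA hcB
    have hf3 := stub_cutVertex_factor H x hx A B c c b hAB hc hcA hcB hsep hcA hbB
    rw [pathKernel_self, mul_one] at hf2
    rw [pathKernel_self, one_mul] at hf3
    exact le_of_eq (by rw [pathKernel_comm H x c a, hf2, hf3, hf1])
  -- (2) the `p`-chain, or the mirror `q`-chain, or a contradiction
  by_cases hiii : (H.deleteEdges (H.incidenceSet b)).Reachable a c
  · exact hGL H hH hfin c a b p hca hcb hab hp hcp hpb hii hiii
  by_cases hiii' : (H.deleteEdges (H.incidenceSet a)).Reachable b c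
  · have h := hGL H hH hfin c b a q hcb hca hab.symm hq hcq hqa hii.symm hiii'
    rw [mul_comm, pathKernel_comm H x b a] at h
    exact h
  exfalso
  obtain ⟨γ⟩ := hreach
  by_cases hb : b ∈ γ.bypass.support
  · -- the initial segment `c → b` of the self-avoiding path `γ.bypass : c → a` avoids `a`
    exact hiii' (reachable_deleteEdges_incidenceSet_of_walk _
      (SimpleGraph.Walk.endpoint_notMem_support_takeUntil γ.bypass_isPath hb hab)).symm
  · exact hiii (reachable_deleteEdges_incidenceSet_of_walk _ hb).symm

end Summit.CriticalPhenomena.SAWScalingLimit.Theorems.LeftRightFKG.CornerGadget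

end
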